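import Summits.QuantumFields.BalabanUV.T4Continuum.Spine.NE9.MemoryFromRate
import Literature.Computability.Cryptography.PolyTimeComputableRealsSqrt

/-!
# T⁴ programme, spine estimate NE9 (node U3, history side) — HOW MUCH OF NE9's LIPSCHITZ HALF IS LOAD-BEARING GIVEN THE TOWER
# η-RATE: a MODULUS OF CONTINUITY in the young couplings suffices for node U3 → U6 (Hölder is an instance), and NE9's literal
# LIPSCHITZ SHAPE can FAIL on a tower for which the node closes — census item of cell `pub-balaban-gaps`, seat ne9 (gen 4), row C25

Cell `pub-balaban-gaps` (YM blitz G2, seat ne9, unit `pub-balaban-gaps-ne9-g4`; record `run/shared/lean/pub/pub-balaban-gaps/ne/NE9.md` §5 row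
C25).  Summits-side bookkeeping continuing gen 3's `MemoryFromRate` (row C24), whose verdict was: GIVEN tower-NE5 (the spine's NE5 for every
consecutive pair of run lengths), the DECAY half of NE9 (`T4OutputRate.FadingMemory`) is derived and node U3 → U6 closes from ANY
coordinatewise Lipschitz moduli of at most geometric growth — «NE9's independent content is its LIPSCHITZ half».  This file asks how much
of that Lipschitz half the node really uses, on the same abstract tower `F : ℕ → (ℕ → ℝ) → ℝ` (one physical localization domain; `F m g` =
its term in the run in which it has scale index `m`; decay factor stripped) and with the same by-name sockets
(`MemoryFromRate.{osc_le_of_towerRate, summable_delta_of_bounded, summable_delta_of_growing, firstMoment_profiles}`); the elementary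
`|√u − √v| ≤ √|u − v|` is imported BY NAME from `Literature.Computability.Cryptography.abs_sqrt_sub_sqrt_le` (gate dedup rule).

RESULTS (kernel-checked, real analysis on hypothesis SHAPES):
* §1 `split_bound_mod`, `bracket_le_of_bounded_mod`, `bracket_le_of_growing_mod`: gen 3's young∕old split and both pointwise majorants hold
  VERBATIM when NE9's coordinate cost `Λ m i·|g_i − g'_i|` is replaced by `Λ m i·ω(|g_i − g'_i|)` for ANY `ω : ℝ → ℝ` with `ω 0 = 0` and
  `ω ≥ 0` on `[0, ∞)` — a MODULUS OF CONTINUITY per young coupling instead of a Lipschitz constant.  Node U6's socket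
  (`summable_delta_of_bounded` ∕ `_of_growing`, BY NAME) then consumes the ω-IMAGE of node U2's discrepancy profile: all it asks is that
  `i ↦ ω(d_i)` have a finite first moment (bounded moduli) resp. be geometric (growing moduli).
* §2 HÖLDER instance (`ω t = t^α`, any `0 < α ≤ 1`… indeed any `α > 0`): node U2's geometric profile `D·θ′^i` has ω-image `D^α·(θ′^α)^i`,
  again geometric (`rpow_le_geometric`), so `bracket_le_of_holder_bounded` ∕ `summable_delta_of_holder_bounded` and
  `bracket_le_of_holder_growing` ∕ `summable_delta_of_holder_growing` close node U3 → U6 from HÖLDER moduli in the couplings, with the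
  exchange `θ′ ↦ θ′^α` and nothing else.
* §3 `exists_holderTower_not_lipschitzShape`: on the window `]0, γ]` the tower `F m g = √|g_{m−2} − γ∕2|` (`m ≥ 2`; `0` below) has the tower
  rate (constant `√γ·θ⁻¹`, any `0 < θ < 1`), depends on ONE coupling of age two, satisfies the Hölder-½ shape with the bounded moduli
  `𝟙_{i = m−2}`, and violates NE9's LIPSCHITZ shape for EVERY moduli family `Λ` — while §2 closes node U3 → U6 for it.
VERDICT FOR THE ROW (C25): GIVEN tower-NE5, the LIPSCHITZ SHAPE of `T4OutputRate.NE9` is NOT load-bearing for node U3 → U6 either; what the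
node consumes from the E-side is a QUANTITATIVE MODULUS OF CONTINUITY of the scale-`m` term in each of its YOUNG couplings whose constants
grow at most geometrically with the age and whose image of node U2's discrepancy profile stays summable with a first moment (Hölder ✓; by
the companion file `MemoryFromRateSharp`, bare continuity ✗).  NEUTRAL for the classification: for Bałaban's `E^{(j)}` the modulus —
Lipschitz or Hölder alike — must still come from the one-step renormalization transformation as a Lean object (W1), whose printed type of
dependence on the last coupling is anyway `C^∞` ([Balaban1987RG1] p. 263 *"It is a C^∞-function of g_{j−1} ∈ [0, γ], (or analytic)"*);
Hölder is not cheaper than Lipschitz there.  The row's residual is thus stated at its weakest: «a modulus of continuity with geometric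
age-growth for the young couplings» — still W1.

HONEST FRAMING: bookkeeping for rung (B)+1 on a FIXED finite four-torus; tower-NE5 is the cell's estimate NE5 (NOT PRINTED, NOT PROVED)
assumed for every consecutive pair of run lengths; NE9 NOT PRINTED ∕ NOT PROVED; spine PROVED 0∕9 unchanged; NOT UV stability, NOT the
continuum limit, NOT infinite volume, NOT a mass gap, NOT Clay.  HONEST DEPENDENCY: continuum YM on T⁴ ⇐ BetaPertH ∧ nine spine estimates
(0∕9 proved); BetaPertH ⇐ (D1) ∧ (D4) ∧ CAP+tail.

References (TYPES only): [Balaban1987RG1] = T. Bałaban, Commun. Math. Phys. **109** (1987) 249–301, Thm 1 p. 259, p. 263, p. 298.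
-/

namespace Summit.QuantumFields.BalabanUV.T4Continuum.NE9.MemoryFromRateModulus

open scoped BigOperators
open Finset Filter Topology
open Literature.MathematicalPhysics.QuantumFieldTheory.Balaban1983to89
open Literature.MathematicalPhysics.QuantumFieldTheory.Balaban1983to89.T4OutputRate
open T4CauchySum (delta)
open Summit.QuantumFields.BalabanUV.T4Continuum.NE9.MemoryFromRate

variable {W : Set (ℕ → ℝ)} {F : ℕ → (ℕ → ℝ) → ℝ}

/-! ## §1 The split and both majorants with a modulus of continuity in place of the Lipschitz cost -/

/-- **THE SPLIT WITH A MODULUS.**  Tower rate on a shift- and hybrid-closed window + a coordinatewise MODULUS shape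
`|F m g − F m g'| ≤ Σ_{i<m} Λ m i·ω(|g_i − g'_i|)` with `ω 0 = 0`: for `a ≤ m`,
`|F m g − F m g'| ≤ 2C₅θ^{m−a}∕(1−θ) + Σ_{i ∈ [a, m)} Λ m i·ω(|g_i − g'_i|)` — gen 3's `split_bound` is the case `ω = id`; the hybrid history
costs nothing on the block where it agrees with `g'` exactly because `ω 0 = 0`. [folklore] -/
theorem split_bound_mod {C₅ θ : ℝ} {Λ : ℕ → ℕ → ℝ} {ω : ℝ → ℝ} (hC : 0 ≤ C₅) (hθ0 : 0 ≤ θ) (hθ1 : θ < 1)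
    (hω : ω 0 = 0)
    (hW : ∀ g ∈ W, (fun i => g (i + 1)) ∈ W)
    (hWmix : ∀ g ∈ W, ∀ g' ∈ W, ∀ a : ℕ, (fun i => if i < a then g' i else g i) ∈ W)
    (hT : ∀ m, ∀ g ∈ W, |F (m + 1) g - F m (fun i => g (i + 1))| ≤ C₅ * θ ^ m)
    (hL : ∀ m, ∀ g ∈ W, ∀ g' ∈ W, |F m g - F m g'| ≤ ∑ i ∈ range m, Λ m i * ω (|g i - g' i|))
    {a m : ℕ} (ham : a ≤ m) {g g' : ℕ → ℝ} (hg : g ∈ W) (hg' : g' ∈ W) :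
    |F m g - F m g'| ≤ 2 * C₅ * θ ^ (m - a) / (1 - θ) + ∑ i ∈ Ico a m, Λ m i * ω (|g i - g' i|) := by
  obtain ⟨k, rfl⟩ := Nat.exists_eq_add_of_le ham
  rw [Nat.add_sub_cancel_left]
  set h : ℕ → ℝ := fun i => if i < a then g' i else g i with hh
  have hhW : h ∈ W := hWmix g hg g' hg' a
  have h1 : |F (a + k) g - F (a + k) h| ≤ 2 * C₅ * θ ^ k / (1 - θ) := by
    rw [add_comm a k]
    exact osc_le_of_towerRate hC hθ0 hθ1 hW hT hg hhW fun i hi => by simp [hh, not_lt.mpr hi]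
  have h2 : |F (a + k) h - F (a + k) g'| ≤ ∑ i ∈ Ico a (a + k), Λ (a + k) i * ω (|g i - g' i|) := by
    refine (hL (a + k) h hhW g' hg').trans (le_of_eq ?_)
    rw [range_eq_Ico, ← sum_Ico_consecutive _ (Nat.zero_le a) (Nat.le_add_right a k),
      sum_eq_zero (fun i hi => ?_), zero_add]
    · exact sum_congr rfl fun i hi => by
        have hia : a ≤ i := (mem_Ico.mp hi).1
        simp [hh, not_lt.mpr hia]
    · have hia : i < a := (mem_Ico.mp hi).2
      simp [hh, hia, hω]
  calc |F (a + k) g - F (a + k) g'| ≤ |F (a + k) g - F (a + k) h| + |F (a + k) h - F (a + k) g'| :=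
        abs_sub_le _ _ _
    _ ≤ _ := add_le_add h1 h2

/-- **BOUNDED MODULI WITH A MODULUS — POINTWISE.**  Tower rate + modulus shape with `0 ≤ Λ m i ≤ C₉` (`i < m`) + an ω-IMAGE profile
`ω(|g_i − g'_i|) ≤ d_i`: `|F m g − F m g'| ≤ 2C₅θ^{m∕2}∕(1−θ) + C₉·Σ_{i ∈ [m∕2, m)} d_i` — the majorant of gen 3's `bracket_le_of_bounded`
verbatim, so `MemoryFromRate.summable_majorant_bounded` ∕ `summable_delta_of_bounded` (finite first moment of `d`) apply BY NAME. [folklore] -/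
theorem bracket_le_of_bounded_mod {C₅ θ C₉ : ℝ} {Λ : ℕ → ℕ → ℝ} {ω : ℝ → ℝ} {d : ℕ → ℝ}
    (hC : 0 ≤ C₅) (hθ0 : 0 ≤ θ) (hθ1 : θ < 1) (hω : ω 0 = 0) (hω0 : ∀ t, 0 ≤ t → 0 ≤ ω t)
    (hW : ∀ g ∈ W, (fun i => g (i + 1)) ∈ W)
    (hWmix : ∀ g ∈ W, ∀ g' ∈ W, ∀ a : ℕ, (fun i => if i < a then g' i else g i) ∈ W)
    (hT : ∀ m, ∀ g ∈ W, |F (m + 1) g - F m (fun i => g (i + 1))| ≤ C₅ * θ ^ m)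
    (hL : ∀ m, ∀ g ∈ W, ∀ g' ∈ W, |F m g - F m g'| ≤ ∑ i ∈ range m, Λ m i * ω (|g i - g' i|))
    (hΛ : ∀ m i, i < m → 0 ≤ Λ m i ∧ Λ m i ≤ C₉)
    {g g' : ℕ → ℝ} (hg : g ∈ W) (hg' : g' ∈ W) (hd : ∀ i, ω (|g i - g' i|) ≤ d i) (m : ℕ) :
    |F m g - F m g'| ≤ 2 * C₅ * θ ^ (m / 2) / (1 - θ) + C₉ * ∑ i ∈ Ico (m / 2) m, d i := by
  have hsplit := split_bound_mod hC hθ0 hθ1 hω hW hWmix hT hL (Nat.sub_le m (m / 2)) hg hg' (a := m - m / 2) (m := m)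
  rw [Nat.sub_sub_self (Nat.div_le_self m 2)] at hsplit
  refine hsplit.trans (add_le_add le_rfl ?_)
  have hω' : ∀ i, 0 ≤ ω (|g i - g' i|) := fun i => hω0 _ (abs_nonneg _)
  have hd0 : ∀ i, 0 ≤ d i := fun i => (hω' i).trans (hd i)
  calc ∑ i ∈ Ico (m - m / 2) m, Λ m i * ω (|g i - g' i|) ≤ ∑ i ∈ Ico (m - m / 2) m, C₉ * d i :=
        sum_le_sum fun i hi => by
          have him : i < m := (mem_Ico.mp hi).2
          exact mul_le_mul (hΛ m i him).2 (hd i) (hω' i) ((hΛ m i him).1.trans (hΛ m i him).2)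
    _ ≤ ∑ i ∈ Ico (m / 2) m, C₉ * d i := by
        refine sum_le_sum_of_subset_of_nonneg (fun i hi => ?_) fun i _ _ =>
          mul_nonneg ((hΛ 1 0 Nat.one_pos).1.trans (hΛ 1 0 Nat.one_pos).2) (hd0 i)
        simp only [mem_Ico] at hi ⊢
        omega
    _ = C₉ * ∑ i ∈ Ico (m / 2) m, d i := by rw [mul_sum]

/-- **GROWING MODULI WITH A MODULUS — POINTWISE.**  Tower rate + modulus shape with `0 ≤ Λ m i ≤ C₉·μ^{m−i}` (`i < m`, ANY `μ ≥ 1`) + a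
GEOMETRIC ω-image profile `ω(|g_i − g'_i|) ≤ D·θ′^i` (`0 ≤ θ′ ≤ 1`) + an integer `N ≥ 1`: the majorant of gen 3's `bracket_le_of_growing`
verbatim, `2C₅θ^{m∕N}∕(1−θ) + C₉D·(m∕N)·(μθ′^{N−1})^{m∕N}`, so `MemoryFromRate.summable_majorant_growing` ∕ `summable_delta_of_growing`
(`μθ′^{N−1} < 1`) apply BY NAME. [folklore] -/
theorem bracket_le_of_growing_mod {C₅ θ C₉ μ D θ' : ℝ} {Λ : ℕ → ℕ → ℝ} {ω : ℝ → ℝ}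
    (hC : 0 ≤ C₅) (hθ0 : 0 ≤ θ) (hθ1 : θ < 1) (hω : ω 0 = 0) (hω0 : ∀ t, 0 ≤ t → 0 ≤ ω t)
    (hμ : 1 ≤ μ) (hD : 0 ≤ D) (hθ'0 : 0 ≤ θ') (hθ'1 : θ' ≤ 1)
    (hW : ∀ g ∈ W, (fun i => g (i + 1)) ∈ W)
    (hWmix : ∀ g ∈ W, ∀ g' ∈ W, ∀ a : ℕ, (fun i => if i < a then g' i else g i) ∈ W)
    (hT : ∀ m, ∀ g ∈ W, |F (m + 1) g - F m (fun i => g (i + 1))| ≤ C₅ * θ ^ m)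
    (hL : ∀ m, ∀ g ∈ W, ∀ g' ∈ W, |F m g - F m g'| ≤ ∑ i ∈ range m, Λ m i * ω (|g i - g' i|))
    (hΛ : ∀ m i, i < m → 0 ≤ Λ m i ∧ Λ m i ≤ C₉ * μ ^ (m - i))
    {g g' : ℕ → ℝ} (hg : g ∈ W) (hg' : g' ∈ W) (hd : ∀ i, ω (|g i - g' i|) ≤ D * θ' ^ i) {N : ℕ} (hN : 1 ≤ N)
    (m : ℕ) :
    |F m g - F m g'| ≤
      2 * C₅ * θ ^ (m / N) / (1 - θ) + C₉ * D * (m / N : ℕ) * (μ * θ' ^ (N - 1)) ^ (m / N) := by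
  have hMle : m / N ≤ m := Nat.div_le_self m N
  have hsplit := split_bound_mod hC hθ0 hθ1 hω hW hWmix hT hL (Nat.sub_le m (m / N)) hg hg'
  rw [Nat.sub_sub_self hMle] at hsplit
  refine hsplit.trans (add_le_add le_rfl ?_)
  have hω' : ∀ i, 0 ≤ ω (|g i - g' i|) := fun i => hω0 _ (abs_nonneg _)
  have hC9 : 0 ≤ C₉ := by
    have h10 := hΛ 1 0 Nat.one_pos
    have hμpos : 0 < μ ^ (1 - 0) := pow_pos (by linarith) _
    have h0 : 0 * μ ^ (1 - 0) ≤ C₉ * μ ^ (1 - 0) := by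
      rw [zero_mul]
      exact h10.1.trans h10.2
    exact le_of_mul_le_mul_right h0 hμpos
  have hNM : N * (m / N) ≤ m := Nat.mul_div_le m N
  set M := m / N with hM
  have hterm : ∀ i ∈ Ico (m - M) m, Λ m i * ω (|g i - g' i|) ≤ C₉ * μ ^ M * (D * θ' ^ (m - M)) := by
    intro i hi
    obtain ⟨hi1, hi2⟩ := mem_Ico.mp hi
    have hΛi := hΛ m i hi2
    have hpow1 : μ ^ (m - i) ≤ μ ^ M := pow_le_pow_right₀ hμ (by omega)
    have hpow2 : θ' ^ i ≤ θ' ^ (m - M) := pow_le_pow_of_le_one hθ'0 hθ'1 hi1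
    calc Λ m i * ω (|g i - g' i|) ≤ (C₉ * μ ^ (m - i)) * (D * θ' ^ i) :=
          mul_le_mul hΛi.2 (hd i) (hω' i) (hΛi.1.trans hΛi.2)
      _ ≤ (C₉ * μ ^ M) * (D * θ' ^ (m - M)) :=
          mul_le_mul (mul_le_mul_of_nonneg_left hpow1 hC9) (mul_le_mul_of_nonneg_left hpow2 hD)
            (by positivity) (by positivity)
  have hexp : (N - 1) * M ≤ m - M := by
    have h2 : (N - 1) * M + M = N * M := by
      rw [← Nat.succ_mul, Nat.succ_eq_add_one, Nat.sub_add_cancel hN]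
    rw [← h2] at hNM
    exact Nat.le_sub_of_add_le hNM
  have hpow3 : θ' ^ (m - M) ≤ θ' ^ ((N - 1) * M) := pow_le_pow_of_le_one hθ'0 hθ'1 hexp
  calc ∑ i ∈ Ico (m - M) m, Λ m i * ω (|g i - g' i|)
      ≤ ∑ i ∈ Ico (m - M) m, C₉ * μ ^ M * (D * θ' ^ (m - M)) := sum_le_sum hterm
    _ = (M : ℝ) * (C₉ * μ ^ M * (D * θ' ^ (m - M))) := by
        rw [sum_const, Nat.card_Ico, Nat.sub_sub_self hMle, nsmul_eq_mul]
    _ ≤ (M : ℝ) * (C₉ * μ ^ M * (D * θ' ^ ((N - 1) * M))) := by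
        refine mul_le_mul_of_nonneg_left ?_ (Nat.cast_nonneg _)
        exact mul_le_mul_of_nonneg_left (mul_le_mul_of_nonneg_left hpow3 hD) (by positivity)
    _ = C₉ * D * (M : ℝ) * (μ * θ' ^ (N - 1)) ^ M := by
        rw [mul_pow, ← pow_mul]
        ring

/-! ## §2 The Hölder instance: node U2's geometric profile has a geometric ω-image -/

/-- The ω-image of a geometric bound under a power modulus: `0 ≤ t ≤ D·θ′^i`, `α ≥ 0` ⇒ `t^α ≤ D^α·(θ′^α)^i`. [folklore] -/
theorem rpow_le_geometric {t D θ' α : ℝ} (ht : 0 ≤ t) (hD : 0 ≤ D) (hθ' : 0 ≤ θ') (hα : 0 ≤ α) {i : ℕ}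
    (h : t ≤ D * θ' ^ i) : t ^ α ≤ D ^ α * (θ' ^ α) ^ i := by
  calc t ^ α ≤ (D * θ' ^ i) ^ α := Real.rpow_le_rpow ht h hα
    _ = D ^ α * (θ' ^ i) ^ α := Real.mul_rpow hD (pow_nonneg hθ' i)
    _ = D ^ α * (θ' ^ α) ^ i := by
        rw [← Real.rpow_natCast θ' i, ← Real.rpow_natCast (θ' ^ α) i, ← Real.rpow_mul hθ',
          ← Real.rpow_mul hθ', mul_comm (i : ℝ) α]

/-- **HÖLDER MODULI, BOUNDED — POINTWISE.**  Tower rate + the Hölder shape `|F m g − F m g'| ≤ Σ_{i<m} Λ m i·|g_i − g'_i|^α` (`α > 0`) with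
bounded `Λ ≤ C₉` + node U2's geometric profile `|g_i − g'_i| ≤ D·θ′^i`:
`|F m g − F m g'| ≤ 2C₅θ^{m∕2}∕(1−θ) + C₉·Σ_{i ∈ [m∕2, m)} D^α(θ′^α)^i`. [folklore] -/
theorem bracket_le_of_holder_bounded {C₅ θ C₉ D θ' α : ℝ} {Λ : ℕ → ℕ → ℝ}
    (hC : 0 ≤ C₅) (hθ0 : 0 ≤ θ) (hθ1 : θ < 1) (hα : 0 < α) (hD : 0 ≤ D) (hθ'0 : 0 ≤ θ')
    (hW : ∀ g ∈ W, (fun i => g (i + 1)) ∈ W)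
    (hWmix : ∀ g ∈ W, ∀ g' ∈ W, ∀ a : ℕ, (fun i => if i < a then g' i else g i) ∈ W)
    (hT : ∀ m, ∀ g ∈ W, |F (m + 1) g - F m (fun i => g (i + 1))| ≤ C₅ * θ ^ m)
    (hL : ∀ m, ∀ g ∈ W, ∀ g' ∈ W, |F m g - F m g'| ≤ ∑ i ∈ range m, Λ m i * |g i - g' i| ^ α)
    (hΛ : ∀ m i, i < m → 0 ≤ Λ m i ∧ Λ m i ≤ C₉)
    {g g' : ℕ → ℝ} (hg : g ∈ W) (hg' : g' ∈ W) (hd : ∀ i, |g i - g' i| ≤ D * θ' ^ i) (m : ℕ) :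
    |F m g - F m g'| ≤ 2 * C₅ * θ ^ (m / 2) / (1 - θ) + C₉ * ∑ i ∈ Ico (m / 2) m, D ^ α * (θ' ^ α) ^ i :=
  bracket_le_of_bounded_mod (ω := fun t => t ^ α) hC hθ0 hθ1 (Real.zero_rpow hα.ne')
    (fun _ ht => Real.rpow_nonneg ht α) hW hWmix hT hL hΛ hg hg'
    (fun i => rpow_le_geometric (abs_nonneg _) hD hθ'0 hα.le (hd i)) m

/-- **HÖLDER MODULI, BOUNDED ⇒ NODE U6.**  `0 ≤ θ′ < 1`, `α > 0` ⇒ `0 ≤ θ′^α < 1`, so the ω-image profile `D^α(θ′^α)^i` has a finite first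
moment and every injection dominated by the majorant of `bracket_le_of_holder_bounded` (`j ≤ K`) has `Summable (T4CauchySum.delta E ρ inj)`
— `MemoryFromRate.summable_delta_of_bounded` BY NAME.  Node U3 → U6 from HÖLDER dependence on the couplings. [folklore] -/
theorem summable_delta_of_holder_bounded {C₅ θ C₉ D θ' α : ℝ} (hC : 0 ≤ C₅) (hθ0 : 0 ≤ θ) (hθ1 : θ < 1) (hC9 : 0 ≤ C₉)
    (hD : 0 ≤ D) (hθ'0 : 0 ≤ θ') (hθ'1 : θ' < 1) (hα : 0 < α)
    {E ρ : ℝ} (hE : 0 ≤ E) (hρ : 0 ≤ ρ) (hρ1 : ρ < 1) {inj : ℕ → ℕ → ℝ}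
    (hinj : ∀ K j : ℕ, j ≤ K → 0 ≤ inj K j ∧
      inj K j ≤ 2 * C₅ * θ ^ (j / 2) / (1 - θ) + C₉ * ∑ i ∈ Ico (j / 2) j, D ^ α * (θ' ^ α) ^ i) :
    Summable (delta E ρ inj) :=
  summable_delta_of_bounded hC hθ0 hθ1 hC9 (d := fun i => D ^ α * (θ' ^ α) ^ i)
    (fun i => mul_nonneg (Real.rpow_nonneg hD α) (pow_nonneg (Real.rpow_nonneg hθ'0 α) i))
    (firstMoment_profiles (Cθ := D ^ α) (L := 0) (ρ₂ := 0) (Real.rpow_nonneg hθ'0 α)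
      (Real.rpow_lt_one hθ'0 hθ'1 hα) le_rfl zero_lt_one).1
    hE hρ hρ1 hinj

/-- **HÖLDER MODULI, GROWING — POINTWISE.**  Tower rate + Hölder shape with `0 ≤ Λ m i ≤ C₉·μ^{m−i}` (ANY `μ ≥ 1`) + node U2's geometric
profile (`0 ≤ θ′ ≤ 1`) + `N ≥ 1`: `|F m g − F m g'| ≤ 2C₅θ^{m∕N}∕(1−θ) + C₉D^α·(m∕N)·(μ(θ′^α)^{N−1})^{m∕N}`. [folklore] -/
theorem bracket_le_of_holder_growing {C₅ θ C₉ μ D θ' α : ℝ} {Λ : ℕ → ℕ → ℝ}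
    (hC : 0 ≤ C₅) (hθ0 : 0 ≤ θ) (hθ1 : θ < 1) (hα : 0 < α) (hμ : 1 ≤ μ) (hD : 0 ≤ D) (hθ'0 : 0 ≤ θ')
    (hθ'1 : θ' ≤ 1)
    (hW : ∀ g ∈ W, (fun i => g (i + 1)) ∈ W)
    (hWmix : ∀ g ∈ W, ∀ g' ∈ W, ∀ a : ℕ, (fun i => if i < a then g' i else g i) ∈ W)
    (hT : ∀ m, ∀ g ∈ W, |F (m + 1) g - F m (fun i => g (i + 1))| ≤ C₅ * θ ^ m)
    (hL : ∀ m, ∀ g ∈ W, ∀ g' ∈ W, |F m g - F m g'| ≤ ∑ i ∈ range m, Λ m i * |g i - g' i| ^ α)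
    (hΛ : ∀ m i, i < m → 0 ≤ Λ m i ∧ Λ m i ≤ C₉ * μ ^ (m - i))
    {g g' : ℕ → ℝ} (hg : g ∈ W) (hg' : g' ∈ W) (hd : ∀ i, |g i - g' i| ≤ D * θ' ^ i) {N : ℕ} (hN : 1 ≤ N)
    (m : ℕ) :
    |F m g - F m g'| ≤
      2 * C₅ * θ ^ (m / N) / (1 - θ) + C₉ * D ^ α * (m / N : ℕ) * (μ * (θ' ^ α) ^ (N - 1)) ^ (m / N) :=
  bracket_le_of_growing_mod (ω := fun t => t ^ α) hC hθ0 hθ1 (Real.zero_rpow hα.ne')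
    (fun _ ht => Real.rpow_nonneg ht α) hμ (Real.rpow_nonneg hD α) (Real.rpow_nonneg hθ'0 α)
    (Real.rpow_le_one hθ'0 hθ'1 hα.le) hW hWmix hT hL hΛ hg hg'
    (fun i => rpow_le_geometric (abs_nonneg _) hD hθ'0 hα.le (hd i)) hN m

/-- **HÖLDER MODULI, GROWING ⇒ NODE U6 (clause N2 idle, Hölder version).**  With `q = μ·(θ′^α)^{N−1} < 1` for the chosen `N ≥ 1` (such an
`N` exists whenever `θ′ < 1`, whatever `μ` and `α > 0`), every injection dominated by the majorant of `bracket_le_of_holder_growing` has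
`Summable (T4CauchySum.delta E ρ inj)` — `MemoryFromRate.summable_delta_of_growing` BY NAME. [folklore] -/
theorem summable_delta_of_holder_growing {C₅ θ C₉ D α q : ℝ} (hC : 0 ≤ C₅) (hθ0 : 0 ≤ θ) (hθ1 : θ < 1) (hC9 : 0 ≤ C₉)
    (hD : 0 ≤ D) (hq0 : 0 ≤ q) (hq1 : q < 1) {N : ℕ} (hN : 1 ≤ N)
    {E ρ : ℝ} (hE : 0 ≤ E) (hρ : 0 ≤ ρ) (hρ1 : ρ < 1) {inj : ℕ → ℕ → ℝ}
    (hinj : ∀ K j : ℕ, j ≤ K → 0 ≤ inj K j ∧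
      inj K j ≤ 2 * C₅ * θ ^ (j / N) / (1 - θ) + C₉ * D ^ α * (j / N : ℕ) * q ^ (j / N)) :
    Summable (delta E ρ inj) :=
  summable_delta_of_growing hC hθ0 hθ1 hC9 (Real.rpow_nonneg hD α) hq0 hq1 hN hE hρ hρ1 hinj

/-! ## §3 A Hölder tower on which NE9's Lipschitz shape fails (while §2 closes node U3 → U6 for it) -/

/-- **A HÖLDER TOWER ON WHICH THE LIPSCHITZ SHAPE FAILS.**  On the window `]0, γ]` (`γ > 0`) the tower
`F m g = √|g_{m−2} − γ∕2|` for `m ≥ 2` (`0` for `m < 2`) (i) has the tower rate `|F (m+1) g − F m (g ∘ succ)| ≤ (√γ·θ⁻¹)·θ^m` for every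
`0 < θ < 1` (it is EXACT above level 2: the term of age-two dependence is reproduced one level up); (ii) depends on the single coupling of
age two (in particular not on the last one); (iii) satisfies the HÖLDER-½ shape `|F m g − F m g'| ≤ Σ_{i<m} 𝟙_{i = m−2}·√|g_i − g'_i|` with
moduli bounded by `1` — so §2 closes node U3 → U6 for it against node U2's geometric profile; and (iv) violates NE9's LIPSCHITZ shape
`|F m g − F m g'| ≤ Σ_{i<m} Λ m i·|g_i − g'_i|` on the window for EVERY family `Λ` (level 2, histories `γ∕2` and `γ∕2 + t`: `√t ≤ Λ 2 0·t` fails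
for small `t`).  The Lipschitz SHAPE of `T4OutputRate.NE9` is therefore not what node U3 → U6 consumes GIVEN tower-NE5. [folklore] -/
theorem exists_holderTower_not_lipschitzShape {γ : ℝ} (hγ : 0 < γ) :
    ∃ F : ℕ → (ℕ → ℝ) → ℝ,
      (∀ θ : ℝ, 0 < θ → θ < 1 → ∀ m, ∀ g ∈ Window γ,
          |F (m + 1) g - F m (fun i => g (i + 1))| ≤ Real.sqrt γ * θ⁻¹ * θ ^ m) ∧
      (∀ m (g g' : ℕ → ℝ), g (m - 2) = g' (m - 2) → F m g = F m g') ∧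
      (∀ m, ∀ g ∈ Window γ, ∀ g' ∈ Window γ,
          |F m g - F m g'| ≤
            ∑ i ∈ range m, (if i = m - 2 then (1 : ℝ) else 0) * Real.sqrt |g i - g' i|) ∧
      ¬ ∃ Λ : ℕ → ℕ → ℝ, ∀ m, ∀ g ∈ Window γ, ∀ g' ∈ Window γ,
          |F m g - F m g'| ≤ ∑ i ∈ range m, Λ m i * |g i - g' i| := by
  set F : ℕ → (ℕ → ℝ) → ℝ := fun m g => if 2 ≤ m then Real.sqrt |g (m - 2) - γ / 2| else 0 with hF
  have hFle : ∀ m, ∀ g ∈ Window γ, 2 ≤ m → F m g ≤ Real.sqrt γ := by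
    intro m g hg hm
    simp only [hF, hm, if_true]
    refine Real.sqrt_le_sqrt ?_
    have h1 := (hg (m - 2)).1
    have h2 := (hg (m - 2)).2
    rw [abs_le]
    constructor <;> linarith
  refine ⟨F, fun θ hθ0 hθ1 m g hg => ?_, fun m g g' hgg' => ?_, fun m g hg g' hg' => ?_, ?_⟩
  · -- (i) tower rate
    rcases Nat.lt_or_ge m 2 with hm | hm
    · interval_cases m
      · have e1 : F (0 + 1) g = 0 := by simp [hF]
        have e0 : F 0 (fun i => g (i + 1)) = 0 := by simp [hF]
        rw [e1, e0, sub_self, abs_zero]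
        positivity
      · have e1 : F 1 (fun i => g (i + 1)) = 0 := by simp [hF]
        have h2 := hFle 2 g hg le_rfl
        have h0 : 0 ≤ F 2 g := by simp only [hF, le_refl, if_true]; exact Real.sqrt_nonneg _
        rw [show (1 : ℕ) + 1 = 2 from rfl, e1, sub_zero, abs_of_nonneg h0, pow_one, mul_assoc,
          inv_mul_cancel₀ hθ0.ne', mul_one]
        exact h2
    · have e1 : F (m + 1) g = Real.sqrt |g (m - 1) - γ / 2| := by
        simp only [hF, show 2 ≤ m + 1 by omega, if_true, show m + 1 - 2 = m - 1 by omega]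
      have e2 : F m (fun i => g (i + 1)) = Real.sqrt |g (m - 1) - γ / 2| := by
        simp only [hF, hm, if_true, show m - 2 + 1 = m - 1 by omega]
      rw [e1, e2, sub_self, abs_zero]
      positivity
  · -- (ii) age-two dependence only
    simp only [hF, hgg']
  · -- (iii) Hölder-½ shape with the indicator moduli
    rcases Nat.lt_or_ge m 2 with hm | hm
    · have h0 : ∀ g₁ : ℕ → ℝ, F m g₁ = 0 := fun g₁ => by simp [hF, not_le.mpr hm]
      rw [h0 g, h0 g', sub_self, abs_zero]
      exact sum_nonneg fun i _ => mul_nonneg (by split_ifs <;> norm_num) (Real.sqrt_nonneg _)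
    · have hmem : m - 2 ∈ range m := mem_range.mpr (by omega)
      rw [sum_eq_single_of_mem (m - 2) hmem (fun i _ hi => by simp [hi]), if_pos rfl, one_mul]
      simp only [hF, hm, if_true]
      calc abs (Real.sqrt |g (m - 2) - γ / 2| - Real.sqrt |g' (m - 2) - γ / 2|)
          ≤ Real.sqrt (abs (|g (m - 2) - γ / 2| - |g' (m - 2) - γ / 2|)) :=
            Literature.Computability.Cryptography.abs_sqrt_sub_sqrt_le (abs_nonneg _) (abs_nonneg _)
        _ ≤ Real.sqrt |g (m - 2) - g' (m - 2)| := by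
            refine Real.sqrt_le_sqrt ?_
            have := abs_abs_sub_abs_le_abs_sub (g (m - 2) - γ / 2) (g' (m - 2) - γ / 2)
            rwa [show g (m - 2) - γ / 2 - (g' (m - 2) - γ / 2) = g (m - 2) - g' (m - 2) by ring] at this
  · -- (iv) no Lipschitz family
    rintro ⟨Λ, hΛ⟩
    -- level 2, histories c and c + t·𝟙₀ with t = min (γ/2) (1/(Λ 2 0 + 1)^2)/… : √t ≤ Λ 2 0 · t forces Λ 2 0 ≥ 1/√t
    set L := Λ 2 0 with hLdef
    -- choose t with 0 < t ≤ γ/2 and (|L|+1)^2 · t < 1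
    obtain ⟨t, ht0, htγ, htL⟩ : ∃ t : ℝ, 0 < t ∧ t ≤ γ / 2 ∧ (|L| + 1) ^ 2 * t < 1 := by
      refine ⟨min (γ / 2) (1 / (2 * (|L| + 1) ^ 2)), lt_min (by linarith) (by positivity), min_le_left _ _, ?_⟩
      have hpos : 0 < (|L| + 1) ^ 2 := by positivity
      calc (|L| + 1) ^ 2 * min (γ / 2) (1 / (2 * (|L| + 1) ^ 2))
          ≤ (|L| + 1) ^ 2 * (1 / (2 * (|L| + 1) ^ 2)) := mul_le_mul_of_nonneg_left (min_le_right _ _) hpos.le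
        _ = 1 / 2 := by field_simp
        _ < 1 := by norm_num
    set g : ℕ → ℝ := fun _ => γ / 2 with hg
    set g' : ℕ → ℝ := fun i => if i = 0 then γ / 2 + t else γ / 2 with hg'
    have hgW : g ∈ Window γ := fun i => ⟨by simp [hg]; linarith, by simp [hg]; linarith⟩
    have hg'W : g' ∈ Window γ := by
      intro i
      by_cases hi : i = 0
      · simp only [hg', hi, if_true]; constructor <;> linarith
      · simp only [hg', hi, if_false]; constructor <;> linarith
    have h := hΛ 2 g hgW g' hg'W
    have hF2g : F 2 g = 0 := by simp [hF, hg]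
    have hF2g' : F 2 g' = Real.sqrt t := by
      have e : g' (2 - 2) = γ / 2 + t := by simp [hg']
      simp only [hF, le_refl, if_true, e]
      rw [show γ / 2 + t - γ / 2 = t by ring, abs_of_pos ht0]
    have hsum : ∑ i ∈ range 2, Λ 2 i * |g i - g' i| = L * t := by
      rw [sum_range_succ, sum_range_succ, sum_range_zero, zero_add]
      have e0 : |g 0 - g' 0| = t := by
        have : g 0 - g' 0 = -t := by simp [hg, hg']
        rw [this, abs_neg, abs_of_pos ht0]
      have e1 : |g 1 - g' 1| = 0 := by simp [hg, hg']
      rw [e0, e1, mul_zero, add_zero]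
    rw [hF2g, hF2g', hsum, zero_sub, abs_neg, abs_of_nonneg (Real.sqrt_nonneg _)] at h
    -- h : √t ≤ L * t ⇒ √t ≤ |L| t ⇒ 1 ≤ |L| √t ⇒ 1 ≤ L² t < 1
    have h' : Real.sqrt t ≤ |L| * t := h.trans (mul_le_mul_of_nonneg_right (le_abs_self L) ht0.le)
    have hst : 0 < Real.sqrt t := Real.sqrt_pos.mpr ht0
    have h1 : 1 ≤ |L| * Real.sqrt t := by
      have : Real.sqrt t * 1 ≤ Real.sqrt t * (|L| * Real.sqrt t) := by
        calc Real.sqrt t * 1 = Real.sqrt t := mul_one _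
          _ ≤ |L| * t := h'
          _ = Real.sqrt t * (|L| * Real.sqrt t) := by
              rw [mul_left_comm, Real.mul_self_sqrt ht0.le]
      exact le_of_mul_le_mul_left this hst
    have h2 : 1 ≤ (|L| + 1) ^ 2 * t := by
      have hsq : (|L| * Real.sqrt t) ^ 2 = L ^ 2 * t := by
        rw [mul_pow, Real.sq_sqrt ht0.le, sq_abs]
      have h3 : 1 ≤ (|L| * Real.sqrt t) ^ 2 := by nlinarith
      rw [hsq] at h3
      nlinarith [sq_abs L, abs_nonneg L]
    linarith
end Summit.QuantumFields.BalabanUV.T4Continuum.NE9.MemoryFromRateModulus
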